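import Summits.BirchSwinnertonDyer.BirchSwinnertonDyer.Theorems.ByReductionTypeAtTwoAnalyticMuEisenstein
import HarnessLib

/-!
# Route `ByReductionTypeAtTwo` (K4), crux `OrdMissingLowerBoundAtTwo` (stmt-BirchSwinnertonDyer-19577), line
# `kato-free-lower-sandwich-two` — (★) the flat-Eisenstein criterion from THEOREM B at `p = 2` ALONE, and the glue with the
# span residual (α) replaced by the arithmetic flat-witness residual (W) (`--supports`, helper; prepares skeleton v8)

Cell `bsd-2adic`, lead `cruxlead-stmt-BirchSwinnertonDyer-19577` (g0).  THEOREMS ONLY — no definition, no named fact, no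
`sorry`; closes nothing; BSD is not proved by any of this.

* `factorsThroughD_of_flat` (★): `N` odd, `κ : Γ₀(N) → ℤ/q` killing finite-order and trace-`±2` elements and FLAT of slope
  `sl` (`κ(γ) = k·sl` when `|d(γ)| = 2ᵏ`), `H ≤ (ℤ/N)ˣ` with `−1 ∈ H ⊇ d(killed)` and `ord sl ∣ e` whenever `2ᵉ ∈ H`: then
  `κ = χ∘(d mod N)`.  Proof: `Θ = (κ, d mod H)` maps the span subgroup for `p = 2` into the cyclic group `⟨(sl, 2 mod H)⟩`;
  THEOREM B (`ConjSpanGenAllLevels.conjSpanGenAll_of_vaserstein_away` + `SL2Rel.Away.relG_le_relE_span_natCast`, in the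
  tree) puts `Γ₁(N)` in the span subgroup, and on `Γ₁(N)` the second coordinate is `1`, forcing the first to be `0`.
  (The crux card's GEN-8 criterion, `Ideas/odd-point-shimura-descent-two.md` §«Round 2 — gen 8», in the tree's vocabulary.)
* `factorsThroughD_of_flat_of_witness`, `exists_eisenstein_of_flat_functional_of_witness` (S3′): with `ord sl ∣ 4` (S2) the
  order hypothesis is discharged by a FLAT WITNESS at level `N` (the card's residual (W) `FlatWitnessAtTwo`, spelled out; the
  element `ρ` may be taken in `⟨killed⟩ ⊔ commutator`).
* `periodDescentOfMeasureDepth_of_flatWitness_of_eisensteinDescent`: the glue of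
  `ByReductionTypeAtTwoAnalyticMuEisenstein` with (α) `∀ odd N, ConjSpanGen N 4 ∧ ConjSpanGen N 16` replaced by (W).
-/

set_option linter.dupNamespace false
set_option autoImplicit false

noncomputable section

namespace Summit.BirchSwinnertonDyer.BirchSwinnertonDyer.Theorems.AnalyticMuTwo

open scoped MatrixGroups ModularForm
open CongruenceSubgroup WeierstrassCurve Literature.NumberTheory.EllipticCurves
  Literature.NumberTheory.EllipticCurves.ModularForms Literature.NumberTheory.EllipticCurves.Rank1Residual
  Literature.NumberTheory.Automorphic
  Summit.BirchSwinnertonDyer.BirchSwinnertonDyer.Theorems.PrintX8VerticalStevens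

section FlatCriterion

variable {N : ℕ}

/-- A homomorphism `Γ₀(N) → A` killing `Γ₁(N)` is a function of `d mod N`. [cite: Stevens1982, §1.1] -/
theorem exists_factor_of_gamma1_le_ker {A : Type*} [CommGroup A] (κ : Gamma0 N →* A)
    (hΓ₁ : ∀ γ : Gamma0 N, γ ∈ Gamma1' N → κ γ = 1) :
    ∃ χ : ZMod N → A, ∀ γ : Gamma0 N, κ γ = χ (Gamma0Map N γ) := by
  classical
  refine ⟨fun x => if hx : ∃ γ : Gamma0 N, Gamma0Map N γ = x then κ hx.choose else 1, fun γ => ?_⟩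
  have hx : ∃ γ' : Gamma0 N, Gamma0Map N γ' = Gamma0Map N γ := ⟨γ, rfl⟩
  dsimp only
  rw [dif_pos hx]
  set c : Gamma0 N := hx.choose with hc_def
  have hc : Gamma0Map N c = Gamma0Map N γ := hx.choose_spec
  have e1 : Gamma0Map N (γ * c⁻¹) * Gamma0Map N c = Gamma0Map N γ := by
    rw [← map_mul, inv_mul_cancel_right]
  have e2 : Gamma0Map N c * Gamma0Map N c⁻¹ = 1 := by
    rw [← map_mul, mul_inv_cancel, map_one]
  have hmem : γ * c⁻¹ ∈ Gamma1' N := by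
    rw [Gamma1_mem']
    calc Gamma0Map N (γ * c⁻¹)
        = Gamma0Map N (γ * c⁻¹) * (Gamma0Map N c * Gamma0Map N c⁻¹) := by rw [e2, mul_one]
      _ = Gamma0Map N γ * Gamma0Map N c⁻¹ := by rw [← mul_assoc, e1]
      _ = Gamma0Map N c * Gamma0Map N c⁻¹ := by rw [hc]
      _ = 1 := e2
  have hκ : κ (γ * c⁻¹) = 1 := hΓ₁ _ hmem
  rw [map_mul, map_inv, mul_inv_eq_one] at hκ
  exact hκ

/-- **(★) the flat-Eisenstein criterion from THEOREM B at `p = 2` alone.**  `N` odd; `κ : Γ₀(N) → ZMod q` (written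
multiplicatively) kills the finite-order and the trace-`±2` elements and is FLAT of slope `sl` (`κ(γ) = k·sl` whenever
`|d(γ)| = 2ᵏ`); `H ≤ (ℤ/N)ˣ` contains `−1` and the `d`-entries of the killed elements, and the additive order of `sl` divides
every `e` with `2ᵉ ∈ H` (i.e. `ord sl ∣ ord(2 mod H)`).  Then `κ` is a function of `d mod N`.  Proof: `Θ = (κ, d mod H)` sends
every generator of the span subgroup for `p = 2` into the cyclic group `⟨(sl, 2 mod H)⟩`, so by THEOREM B
(`ConjSpanGenAllLevels.conjSpanGenAll_of_vaserstein_away`) `Θ(Γ₁(N)) ⊆ ⟨(sl, 2 mod H)⟩ ∩ (ZMod q × 1) = 0`.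
[cite: Manin1972, Prop. 1.4] [cite: Vaserstein1972SL2, Theorem (p. 313)] [cite: Stevens1982, §1.1] -/
theorem factorsThroughD_of_flat (hN : ¬ 2 ∣ N) {q : ℕ} (κ : Gamma0 N →* Multiplicative (ZMod q)) (sl : ZMod q)
    (hfin : ∀ γ : Gamma0 N, IsOfFinOrder γ → κ γ = 1)
    (htr : ∀ γ : Gamma0 N, trEntry γ = 2 ∨ trEntry γ = -2 → κ γ = 1)
    (hflat : ∀ (γ : Gamma0 N) (k : ℕ), (dEntry γ).natAbs = 2 ^ k → κ γ = Multiplicative.ofAdd ((k : ZMod q) * sl))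
    (H : Subgroup (ZMod N)ˣ) (hneg : -1 ∈ H)
    (hH : ∀ γ : Gamma0 N, IsOfFinOrder γ ∨ trEntry γ = 2 ∨ trEntry γ = -2 → ∃ u ∈ H, (u : ZMod N) = Gamma0Map N γ)
    (hord : ∀ e : ℕ, (∃ u ∈ H, (u : ZMod N) = 2 ^ e) → addOrderOf sl ∣ e) :
    ∃ χ : ZMod N → Multiplicative (ZMod q), ∀ γ : Gamma0 N, κ γ = χ (Gamma0Map N γ) := by
  classical
  have hB : ConjSpanGen N 2 :=
    ConjSpanGenAllLevels.conjSpanGenAll_of_vaserstein_away SL2Rel.Away.relG_le_relE_span_natCast N 2 Nat.prime_two hN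
  have hcop : Nat.Coprime 2 N := Nat.coprime_two_left.mpr (Nat.odd_iff.mpr (Nat.two_dvd_ne_zero.mp hN))
  -- the unit `2 mod N`, the `d`-entry as a unit, the test character `ψ = (· mod H)` (all kept opaque)
  obtain ⟨t, ht⟩ : ∃ t : (ZMod N)ˣ, (t : ZMod N) = 2 :=
    ⟨ZMod.unitOfCoprime 2 hcop, by rw [ZMod.coe_unitOfCoprime]; norm_num⟩
  obtain ⟨dU, hdU⟩ : ∃ dU : Gamma0 N →* (ZMod N)ˣ, ∀ γ : Gamma0 N, (dU γ : ZMod N) = Gamma0Map N γ :=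
    ⟨(Gamma0Map N).toHomUnits, fun γ => MonoidHom.coe_toHomUnits _ γ⟩
  obtain ⟨Q, _, ψ, hψ1⟩ : ∃ (Q : Type) (_ : CommGroup Q) (ψ : (ZMod N)ˣ →* Q), ∀ u, ψ u = 1 ↔ u ∈ H :=
    ⟨(ZMod N)ˣ ⧸ H, inferInstance, QuotientGroup.mk' H, fun u => QuotientGroup.eq_one_iff u⟩
  obtain ⟨Θ, hΘ⟩ : ∃ Θ : Gamma0 N →* Multiplicative (ZMod q) × Q, ∀ γ, Θ γ = (κ γ, ψ (dU γ)) :=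
    ⟨κ.prod (ψ.comp dU), fun _ => rfl⟩
  have hneg1 : ψ (-1) = 1 := (hψ1 _).mpr hneg
  -- every span generator for `p = 2` lands in `⟨z⟩`, `z = (sl, ψ 2)`
  have hgen : spanSubgroup N 2 ≤ (Subgroup.zpowers (Multiplicative.ofAdd sl, ψ t)).comap Θ := by
    rw [spanSubgroup]
    refine sup_le ?_ ?_
    · rw [Subgroup.closure_le]
      intro γ hγ
      simp only [spanGenerators, Set.mem_setOf_eq] at hγ
      rw [SetLike.mem_coe, Subgroup.mem_comap, hΘ]
      rcases hγ with ⟨j, hj⟩ | hkill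
      · -- good: `|d| = 2ʲ`, `Θ γ = zʲ`
        have hκγ : κ γ = Multiplicative.ofAdd sl ^ j := by
          rw [hflat γ j hj, ← ofAdd_nsmul, nsmul_eq_mul]
        have hdγ : dU γ = t ^ j ∨ dU γ = -(t ^ j) := by
          rcases Int.natAbs_eq (dEntry γ) with h | h <;> rw [hj] at h
          · left; ext; rw [hdU, ← intCast_dEntry, h, Units.val_pow_eq_pow_val, ht]; push_cast; rfl
          · right; ext; rw [hdU, ← intCast_dEntry, h, Units.val_neg, Units.val_pow_eq_pow_val, ht]; push_cast; rfl
        have hψγ : ψ (dU γ) = ψ t ^ j := by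
          rcases hdγ with h | h
          · rw [h, map_pow]
          · rw [h, ← neg_one_mul, map_mul, map_pow, hneg1, one_mul]
        rw [hκγ, hψγ, ← Prod.pow_mk]
        exact Subgroup.npow_mem_zpowers _ j
      · -- killed: `Θ γ = 1`
        have hκγ : κ γ = 1 := by
          rcases hkill with h | h | h
          · exact hfin γ h
          · exact htr γ (Or.inl h)
          · exact htr γ (Or.inr h)
        obtain ⟨u, huH, hu⟩ := hH γ hkill
        have huγ : dU γ = u := by ext; rw [hdU, hu]
        rw [hκγ, huγ, (hψ1 u).mpr huH, Prod.mk_one_one]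
        exact one_mem _
    · intro γ hγ
      have h1 : Θ γ = 1 := (MonoidHom.mem_ker).1 (Abelianization.commutator_subset_ker Θ hγ)
      rw [Subgroup.mem_comap, h1]
      exact one_mem _
  -- `Γ₁(N)` is killed
  have hΓ₁ : ∀ γ : Gamma0 N, γ ∈ Gamma1' N → κ γ = 1 := by
    intro γ hγ
    have hmem := hgen ((conjSpanGen_iff_gamma1 N 2).1 hB γ hγ)
    rw [Subgroup.mem_comap, Subgroup.mem_zpowers_iff] at hmem
    obtain ⟨e, he⟩ := hmem
    rw [hΘ] at he
    have he1 : Multiplicative.ofAdd sl ^ e = κ γ := congrArg Prod.fst he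
    have he2 : ψ t ^ e = ψ (dU γ) := congrArg Prod.snd he
    have hd1 : dU γ = 1 := by ext; rw [hdU, Gamma1_mem'.mp hγ]; rfl
    rw [hd1, map_one, ← map_zpow, hψ1] at he2
    -- `2^|e| ∈ H`, so `ord sl ∣ |e|`, so `e • sl = 0`
    have hnat : t ^ e.natAbs ∈ H := by
      rcases Int.natAbs_eq e with h | h
      · have : t ^ e = t ^ e.natAbs := by
          conv_lhs => rw [h]
          rw [zpow_natCast]
        rwa [this] at he2
      · have : t ^ e = (t ^ e.natAbs)⁻¹ := by
          conv_lhs => rw [h]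
          rw [zpow_neg, zpow_natCast]
        rw [this] at he2
        simpa using H.inv_mem he2
    have hdvd : addOrderOf sl ∣ e.natAbs :=
      hord e.natAbs ⟨t ^ e.natAbs, hnat, by rw [Units.val_pow_eq_pow_val, ht]⟩
    have hzero : e • sl = 0 := by
      rw [← addOrderOf_dvd_iff_zsmul_eq_zero]
      exact Int.natCast_dvd.mpr hdvd
    rw [← he1, ← ofAdd_zsmul, hzero]
    rfl
  exact exists_factor_of_gamma1_le_ker κ hΓ₁

/-- **(★) with the witness (W)**: if moreover `ord sl ∣ 4` (S2: `a₂ = ±1`) and level `N` carries a FLAT WITNESS — `H ≤ (ℤ/N)ˣ`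
with `−1 ∈ H` and the `d`-entries of the killed (finite-order / trace-`±2`) elements in `H`, and an element `ρ` of the subgroup
generated by the killed elements and commutators with `|d(ρ)| = 2ᵏ` and `gcd(k, 4) ∣ e` whenever `2ᵉ ∈ H` — then `κ` is a
function of `d mod N`: `κ(ρ) = 1` and flatness give `k·sl = 0`, so `ord sl ∣ gcd(k, 4) ∣ ord(2 mod H)` and (★) applies.
(The witness is the crux card's GEN-8 residual `FlatWitnessAtTwo` at level `N`, certified by kit at every odd `N ≤ 30000`.)
[cite: Manin1972, Prop. 1.4] [cite: Vaserstein1972SL2, Theorem (p. 313)] [cite: Stevens1982, §1.1] -/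
theorem factorsThroughD_of_flat_of_witness (hN : ¬ 2 ∣ N) {q : ℕ} (κ : Gamma0 N →* Multiplicative (ZMod q)) (sl : ZMod q)
    (hfin : ∀ γ : Gamma0 N, IsOfFinOrder γ → κ γ = 1)
    (htr : ∀ γ : Gamma0 N, trEntry γ = 2 ∨ trEntry γ = -2 → κ γ = 1)
    (hflat : ∀ (γ : Gamma0 N) (k : ℕ), (dEntry γ).natAbs = 2 ^ k → κ γ = Multiplicative.ofAdd ((k : ZMod q) * sl))
    (h4 : addOrderOf sl ∣ 4)
    (hW : ∃ (H : Subgroup (ZMod N)ˣ) (ρ : Gamma0 N) (k : ℕ), -1 ∈ H ∧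
      (∀ γ : Gamma0 N, IsOfFinOrder γ ∨ trEntry γ = 2 ∨ trEntry γ = -2 → ∃ u ∈ H, (u : ZMod N) = Gamma0Map N γ) ∧
      ρ ∈ Subgroup.closure {γ : Gamma0 N | IsOfFinOrder γ ∨ trEntry γ = 2 ∨ trEntry γ = -2} ⊔ commutator (Gamma0 N) ∧
      (dEntry ρ).natAbs = 2 ^ k ∧
      ∀ e : ℕ, (∃ u ∈ H, (u : ZMod N) = 2 ^ e) → Nat.gcd k 4 ∣ e) :
    ∃ χ : ZMod N → Multiplicative (ZMod q), ∀ γ : Gamma0 N, κ γ = χ (Gamma0Map N γ) := by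
  obtain ⟨H, ρ, k, hneg, hH, hρ, hk, hdiv⟩ := hW
  refine factorsThroughD_of_flat hN κ sl hfin htr hflat H hneg hH (fun e he => ?_)
  -- `κ ρ = 1`: the killed elements and the commutators lie in `ker κ`
  have hker : Subgroup.closure {γ : Gamma0 N | IsOfFinOrder γ ∨ trEntry γ = 2 ∨ trEntry γ = -2} ⊔ commutator (Gamma0 N)
      ≤ κ.ker := by
    refine sup_le ?_ (Abelianization.commutator_subset_ker κ)
    rw [Subgroup.closure_le]
    intro γ hγ
    simp only [Set.mem_setOf_eq] at hγ
    rw [SetLike.mem_coe, MonoidHom.mem_ker]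
    rcases hγ with h | h | h
    · exact hfin γ h
    · exact htr γ (Or.inl h)
    · exact htr γ (Or.inr h)
  have hρ1 : κ ρ = 1 := (MonoidHom.mem_ker).1 (hker hρ)
  rw [hflat ρ k hk] at hρ1
  have hksl : k • sl = 0 := by
    rw [nsmul_eq_mul]
    exact Multiplicative.ofAdd.injective hρ1
  have hdk : addOrderOf sl ∣ k := addOrderOf_dvd_iff_nsmul_eq_zero.mpr hksl
  exact (Nat.dvd_gcd hdk h4).trans (hdiv e he)

variable [NeZero N] (f : CuspForm (Gamma0 N) 2)

/-- **S3′: a `q`-flat integer period functional of slope `sl`, `ord sl ∣ 4`, is EISENSTEIN mod `q` at every odd level carrying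
a flat witness (W)** — `exists_eisenstein_of_flat_functional` with its span input `ConjSpanGen N (2^{ord sl})` (THEOREM B′/B″
for `ord sl = 2, 4`) REPLACED by THEOREM B at `p = 2` (in the tree) and the arithmetic witness (W) at level `N`.
`m : Γ₀(N) → ℤ` with `re{∞,γ∞}_f = m(γ)·Ω⁺_f/2`, `m(γ) ≡ k·sl (mod q)` whenever `|d(γ)| = 2ᵏ`: then `m ≡ χ∘(d mod N)`.
[cite: Manin1972, Prop. 1.4] [cite: Vaserstein1972SL2, Theorem (p. 313)] [cite: Stevens1982, §1.1] -/
theorem exists_eisenstein_of_flat_functional_of_witness {m : Gamma0 N → ℤ}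
    (hm : ∀ γ : Gamma0 N, (cuspSymbol f γ).re = m γ * (plusPeriod f / 2)) (hΩ : plusPeriod f ≠ 0)
    {q : ℕ} (sl : ZMod q) (hflat : ∀ (γ : Gamma0 N) (k : ℕ), (dEntry γ).natAbs = 2 ^ k → ((m γ : ℤ) : ZMod q) = (k : ZMod q) * sl)
    (h4 : addOrderOf sl ∣ 4) (hN : ¬ 2 ∣ N)
    (hW : ∃ (H : Subgroup (ZMod N)ˣ) (ρ : Gamma0 N) (k : ℕ), -1 ∈ H ∧
      (∀ γ : Gamma0 N, IsOfFinOrder γ ∨ trEntry γ = 2 ∨ trEntry γ = -2 → ∃ u ∈ H, (u : ZMod N) = Gamma0Map N γ) ∧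
      ρ ∈ Subgroup.closure {γ : Gamma0 N | IsOfFinOrder γ ∨ trEntry γ = 2 ∨ trEntry γ = -2} ⊔ commutator (Gamma0 N) ∧
      (dEntry ρ).natAbs = 2 ^ k ∧
      ∀ e : ℕ, (∃ u ∈ H, (u : ZMod N) = 2 ^ e) → Nat.gcd k 4 ∣ e) :
    ∃ χ : ZMod N → ZMod q, ∀ γ : Gamma0 N, ((m γ : ℤ) : ZMod q) = χ (Gamma0Map N γ) := by
  have hΩ2 : plusPeriod f / 2 ≠ 0 := div_ne_zero hΩ two_ne_zero
  -- additivity and vanishing from `cuspSymbol`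
  have hmul : ∀ γ δ : Gamma0 N, m (γ * δ) = m γ + m δ := by
    intro γ δ
    have h := hm (γ * δ)
    rw [cuspSymbol_mul_holds f γ δ, Complex.add_re, hm γ, hm δ, ← add_mul] at h
    exact_mod_cast (mul_right_cancel₀ hΩ2 h).symm
  have hzero : ∀ γ : Gamma0 N, cuspSymbol f γ = 0 → m γ = 0 := by
    intro γ h0
    have h := hm γ
    rw [h0, Complex.zero_re] at h
    have : (m γ : ℝ) = 0 := by
      rcases mul_eq_zero.1 h.symm with h1 | h1
      · exact h1
      · exact absurd h1 hΩ2
    exact_mod_cast this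
  have hone : m 1 = 0 := hzero 1 (cuspSymbol_one f)
  -- the functional as a homomorphism to `Multiplicative (ZMod q)`
  let κ : Gamma0 N →* Multiplicative (ZMod q) :=
    { toFun := fun γ => Multiplicative.ofAdd (((m γ : ℤ) : ZMod q))
      map_one' := by simp [hone]
      map_mul' := fun γ δ => by rw [hmul γ δ, ← ofAdd_add]; push_cast; rfl }
  have hκ : ∀ γ, κ γ = Multiplicative.ofAdd (((m γ : ℤ) : ZMod q)) := fun _ => rfl
  have hfin : ∀ γ : Gamma0 N, IsOfFinOrder γ → κ γ = 1 := by
    intro γ hγ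
    rw [hκ, hzero γ (cuspSymbol_eq_zero_of_isOfFinOrder f hγ)]
    simp
  have htr : ∀ γ : Gamma0 N, trEntry γ = 2 ∨ trEntry γ = -2 → κ γ = 1 := by
    intro γ hγ
    rw [hκ, hzero γ (cuspSymbol_eq_zero_of_trEntry f hγ)]
    simp
  have hflatκ : ∀ (γ : Gamma0 N) (k : ℕ), (dEntry γ).natAbs = 2 ^ k →
      κ γ = Multiplicative.ofAdd ((k : ZMod q) * sl) := by
    intro γ k hk
    rw [hκ, hflat γ k hk]
  obtain ⟨χ, hχ⟩ := factorsThroughD_of_flat_of_witness hN κ sl hfin htr hflatκ h4 hW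
  refine ⟨fun x => Multiplicative.toAdd (χ x), fun γ => ?_⟩
  have := hχ γ
  rw [hκ] at this
  show ((m γ : ℤ) : ZMod q) = Multiplicative.toAdd (χ (Gamma0Map N γ))
  rw [← this]
  rfl

end FlatCriterion

section Glue

open Summit.BirchSwinnertonDyer.Rank1Residual
  Literature.NumberTheory.EllipticCurves.Greenberg1999

/-- **v6's research stub from (W) ∧ (β)** — `periodDescentOfMeasureDepth_of_eisensteinDescent` with the span residual (α)
`∀ odd N, ConjSpanGen N 4 ∧ ConjSpanGen N 16` (THEOREM B′/B″: no proof idea, certified at odd `N ≤ 999 / 229`) REPLACED by the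
weaker, purely arithmetic flat-witness residual (W) (the crux card's GEN-8 `FlatWitnessAtTwo`, certified at every odd
`N ≤ 30000`): measure depth `s+1` at an optimal `E₀` ⟹ (S2) flat winding classes of slope `sl`, `4·sl = 0` ⟹ (dictionary) the
integer period functional is flat ⟹ (S3′ = THEOREM B at `p = 2` + (W), `exists_eisenstein_of_flat_functional_of_witness`)
Eisenstein mod `2^{s+1}` ⟹ (β) descent.  Prepares skeleton v8 of line `kato-free-lower-sandwich-two`.
[cite: MazurTateTeitelbaum1986Invent, §I.10] [cite: Manin1972, Prop. 1.4] [cite: Vaserstein1972SL2, Theorem (p. 313)] -/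
theorem periodDescentOfMeasureDepth_of_flatWitness_of_eisensteinDescent
    (hW : ∀ N : ℕ, Odd N →
      ∃ (H : Subgroup (ZMod N)ˣ) (ρ : Gamma0 N) (k : ℕ), -1 ∈ H ∧
      (∀ γ : Gamma0 N, IsOfFinOrder γ ∨ trEntry γ = 2 ∨ trEntry γ = -2 → ∃ u ∈ H, (u : ZMod N) = Gamma0Map N γ) ∧
      ρ ∈ Subgroup.closure {γ : Gamma0 N | IsOfFinOrder γ ∨ trEntry γ = 2 ∨ trEntry γ = -2} ⊔ commutator (Gamma0 N) ∧
      (dEntry ρ).natAbs = 2 ^ k ∧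
      ∀ e : ℕ, (∃ u ∈ H, (u : ZMod N) = 2 ^ e) → Nat.gcd k 4 ∣ e)
    (S4 : ∀ (E₀ : WeierstrassCurve ℚ) [E₀.IsElliptic] [E₀.IsGloballyMinimal] [NeZero (E₀.conductorNorm ℤ)]
      (D₀ : ModularParametrizationData E₀ (E₀.conductorNorm ℤ)),
      (∀ z ∈ D₀.L.lattice, ∃ w ∈ periodLattice D₀.f, z = D₀.c * w) →
      ¬ E₀.HasCM → E₀.analyticRank = 0 → GoodOrd E₀ 2 →
      (∃ (W₁ : WeierstrassCurve ℚ) (_ : W₁.IsElliptic) (_ : W₁.IsGloballyMinimal),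
        IsIsogenous E₀ W₁ ∧ ∃ x : ℚ, HasRationalTwoTorsionX W₁ x) →
      ∀ (s : ℕ) (m : Gamma0 (E₀.conductorNorm ℤ) → ℤ),
        (∀ γ, (cuspSymbol D₀.f γ).re = m γ * (plusPeriod D₀.f / 2)) →
      ∀ χ : ZMod (E₀.conductorNorm ℤ) → ZMod (2 ^ (s + 1)),
        (∀ γ, ((m γ : ℤ) : ZMod (2 ^ (s + 1))) = χ (Gamma0Map (E₀.conductorNorm ℤ) γ)) →
      ∃ (W₃ : WeierstrassCurve ℚ) (_ : W₃.IsElliptic) (_ : W₃.IsGloballyMinimal),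
        IsIsogenous E₀ W₃ ∧ ∃ r : ℚ, W₃.realPeriodRat = (r : ℝ) * E₀.realPeriodRat ∧ ((s : ℤ) + 1) ≤ padicValRat 2 r) :
    ∀ (E₀ : WeierstrassCurve ℚ) [E₀.IsElliptic] [E₀.IsGloballyMinimal] [NeZero (E₀.conductorNorm ℤ)]
      (D₀ : ModularParametrizationData E₀ (E₀.conductorNorm ℤ)),
      (∀ z ∈ D₀.L.lattice, ∃ w ∈ periodLattice D₀.f, z = D₀.c * w) →
      ¬ E₀.HasCM → E₀.analyticRank = 0 → GoodOrd E₀ 2 →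
      (∃ (W₁ : WeierstrassCurve ℚ) (_ : W₁.IsElliptic) (_ : W₁.IsGloballyMinimal),
        IsIsogenous E₀ W₁ ∧ ∃ x : ℚ, HasRationalTwoTorsionX W₁ x) →
      ∀ s : ℕ, (∀ (n : ℕ) (b : ZMod (2 ^ (n + 2))), ¬ 2 ∣ b.val →
        ‖2 * msdMeasure D₀.f (unitRoot E₀ 2 : ℚ_[2]) (n + 2) b‖ ≤ (2 : ℝ) ^ (-((s : ℤ) + 1))) →
      ∃ (W₃ : WeierstrassCurve ℚ) (_ : W₃.IsElliptic) (_ : W₃.IsGloballyMinimal),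
        IsIsogenous E₀ W₃ ∧ ∃ r : ℚ, W₃.realPeriodRat = (r : ℝ) * E₀.realPeriodRat ∧ ((s : ℤ) + 1) ≤ padicValRat 2 r := by
  intro E₀ _ _ _ D₀ hopt hcm hr hgo hW₁ s hν
  haveI : Fact (Nat.Prime 2) := ⟨Nat.prime_two⟩
  have hord : IsOrdinaryAt E₀ 2 := hgo
  obtain ⟨hαeq, hαu, hα0⟩ := unitRoot_coe_spec (W := E₀) hord
  have hf := D₀.isNewformOf
  have hQ : coeffField D₀.f = ⊥ := hf.coeffField_eq_bot
  have h2N : ¬ 2 ∣ E₀.conductorNorm ℤ := not_dvd_level_of_isNewformOf hf hord.1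
  have hNodd : Odd (E₀.conductorNorm ℤ) := by
    rcases Nat.even_or_odd (E₀.conductorNorm ℤ) with h | h
    · exact absurd (even_iff_two_dvd.mp h) h2N
    · exact h
  have ha₂ : cuspCoeff D₀.f 2 = ((E₀.frobeniusTrace 2 : ℤ) : ℂ) := cuspCoeff_eq_frobeniusTrace_of_isNewformOf_holds hf hord.1
  have ha₂' : E₀.frobeniusTrace 2 = 1 ∨ E₀.frobeniusTrace 2 = -1 := by
    have hH : E₀.frobeniusTrace 2 ^ 2 ≤ 8 := by
      have h := E₀.frobeniusTrace_sq_le_four_mul 2 hord.1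
      push_cast at h
      linarith
    have hodd : ¬ (2 : ℤ) ∣ E₀.frobeniusTrace 2 := by exact_mod_cast hord.2
    have hb : -2 ≤ E₀.frobeniusTrace 2 ∧ E₀.frobeniusTrace 2 ≤ 2 := by
      constructor <;> nlinarith [hH, sq_nonneg (E₀.frobeniusTrace 2 + 3), sq_nonneg (E₀.frobeniusTrace 2 - 3)]
    omega
  have hroot : (unitRoot E₀ 2 : ℚ_[2]) ^ 2 - (E₀.frobeniusTrace 2 : ℤ) * (unitRoot E₀ 2 : ℚ_[2]) + 2 = 0 := by
    have := hαeq; push_cast at this ⊢; exact this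
  have hB : (0 : ℝ) ≤ (2 : ℝ) ^ (-((s : ℤ) + 1)) := zpow_nonneg (by norm_num) _
  -- S2: flat winding classes at the 2-power cusps
  have hν' := forall_norm_two_mul_msdMeasure_intCast_le_of_levels_two D₀.f (unitRoot E₀ 2 : ℚ_[2])
    (msdMeasure_distribution_of_isNewformOf hord hf) hB (fun n b hb => hν n b hb)
  obtain ⟨sl, h4sl, hflat⟩ := exists_slope_winding_flat_of_measure_depth hf.1 hQ h2N ha₂ ha₂' hαu hroot hν'
  -- the integer period functional
  have hΩ : plusPeriod D₀.f ≠ 0 := (IsNewform0.plusPeriod_pos_holds hf.1 hQ).ne'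
  choose m hm using SignedMuAtTwo.exists_int_re_cuspSymbol_eq D₀.f hΩ
  -- `b` is odd when `d` is even (`ad − bc = 1`)
  have hbodd_of : ∀ γ : Gamma0 (E₀.conductorNorm ℤ), (2 : ℤ) ∣ dEntry γ → Odd ((γ : SL(2, ℤ)) 0 1 : ℤ) := by
    intro γ hd2
    have hdet : ((γ : SL(2, ℤ)) 0 0 : ℤ) * (γ : SL(2, ℤ)) 1 1 - ((γ : SL(2, ℤ)) 0 1 : ℤ) * (γ : SL(2, ℤ)) 1 0 = 1 := by
      have := Matrix.SpecialLinearGroup.det_coe (γ : SL(2, ℤ))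
      rw [Matrix.det_fin_two] at this; linear_combination this
    change (2 : ℤ) ∣ (γ : SL(2, ℤ)) 1 1 at hd2
    by_contra hb
    rw [Int.not_odd_iff_even] at hb
    obtain ⟨u, hu⟩ := hd2; obtain ⟨v, hv⟩ := hb
    have h1 : (1 : ℤ) = 2 * (((γ : SL(2, ℤ)) 0 0 : ℤ) * u - v * (γ : SL(2, ℤ)) 1 0) := by
      linear_combination -hdet + ((γ : SL(2, ℤ)) 0 0 : ℤ) * hu - ((γ : SL(2, ℤ)) 1 0 : ℤ) * hv
    exact absurd (⟨((γ : SL(2, ℤ)) 0 0 : ℤ) * u - v * (γ : SL(2, ℤ)) 1 0, by linear_combination h1⟩ : Even (1 : ℤ))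
      Int.not_even_one
  -- flatness on the group elements with `|d| = 2ᵏ`
  have hflatG : ∀ (γ : Gamma0 (E₀.conductorNorm ℤ)) (k : ℕ), (dEntry γ).natAbs = 2 ^ k →
      ((m γ : ℤ) : ZMod (2 ^ (s + 1))) = (k : ZMod (2 ^ (s + 1))) * sl := by
    intro γ k hk
    have hd0 : dEntry γ ≠ 0 := by
      intro h0; rw [h0, Int.natAbs_zero] at hk; exact absurd hk (pow_ne_zero k two_ne_zero).symm
    have hdict := functional_eq_two_mul_ratPlusSymbol_sub hf.1 hQ hΩ hm γ hd0
    rcases Nat.eq_zero_or_pos k with rfl | hkpos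
    · -- `d = ±1`: the cusp `b/d` is an integer, `m γ = 0`
      have hd1 : dEntry γ = 1 ∨ dEntry γ = -1 := by
        rcases Int.natAbs_eq (dEntry γ) with h | h <;> rw [hk] at h <;> simp at h <;> tauto
      have hint : ∃ z : ℤ, ((((γ : SL(2, ℤ)) 0 1 : ℤ) : ℚ) / ((dEntry γ : ℤ) : ℚ)) = 0 + (z : ℚ) := by
        rcases hd1 with h | h
        · exact ⟨((γ : SL(2, ℤ)) 0 1 : ℤ), by rw [h]; push_cast; ring⟩
        · exact ⟨-((γ : SL(2, ℤ)) 0 1 : ℤ), by rw [h]; push_cast; ring⟩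
      obtain ⟨z, hz⟩ := hint
      have : (m γ : ℚ) = 0 := by rw [hdict, hz, ratPlusSymbol_add_intCast_eq]; ring
      have hm0 : m γ = 0 := by exact_mod_cast this
      rw [hm0]; simp
    · have hd2 : (2 : ℤ) ∣ dEntry γ := by
        have h : ((2 : ℕ) : ℤ) ∣ dEntry γ :=
          Int.natCast_dvd.mpr (by rw [hk]; exact dvd_pow_self 2 (by omega))
        exact_mod_cast h
      -- the cusp is `(ε b)/2^k` with `ε b` odd
      rcases Int.natAbs_eq (dEntry γ) with hε | hε <;> rw [hk] at hε
      · have hbodd := hbodd_of γ hd2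
        have heq : 2 * (ratPlusSymbol D₀.f ((((γ : SL(2, ℤ)) 0 1 : ℤ) : ℚ) / (2 : ℚ) ^ k) - ratPlusSymbol D₀.f 0) = m γ := by
          rw [hdict, hε]; push_cast; ring
        have h := hflat k _ hbodd (m γ) heq
        rw [h, nsmul_eq_mul]
      · have hbodd : Odd (-((γ : SL(2, ℤ)) 0 1 : ℤ)) := (hbodd_of γ hd2).neg
        have heq : 2 * (ratPlusSymbol D₀.f ((((-((γ : SL(2, ℤ)) 0 1 : ℤ)) : ℤ) : ℚ) / (2 : ℚ) ^ k) - ratPlusSymbol D₀.f 0) = m γ := by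
          rw [hdict, hε]; push_cast
          rw [show ((((γ : SL(2, ℤ)) 0 1 : ℤ) : ℚ)) / -(2 : ℚ) ^ k = -(((γ : SL(2, ℤ)) 0 1 : ℤ) : ℚ) / (2 : ℚ) ^ k by ring]
        have h := hflat k _ hbodd (m γ) heq
        rw [h, nsmul_eq_mul]
  -- S3: Eisenstein mod 2^{s+1}
  have hsl : addOrderOf sl ∣ 4 := addOrderOf_dvd_iff_nsmul_eq_zero.mpr h4sl
  obtain ⟨χ, hχ⟩ := exists_eisenstein_of_flat_functional_of_witness D₀.f hm hΩ sl hflatG hsl h2N (hW _ hNodd)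
  -- (β): descent
  exact S4 E₀ D₀ hopt hcm hr hgo hW₁ s m hm χ hχ

end Glue

end Summit.BirchSwinnertonDyer.BirchSwinnertonDyer.Theorems.AnalyticMuTwo

end
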